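import Mathlib
import HarnessLib

/-!
# The Cauchy–Riemann inequality for the normal section of a push-off (Wendl 2020, Prop. B.28, flat)

Pointwise, chart-free form of Wendl 2020, App. B, Prop. B.28 in the explicit flat setting of
§B.2.3–B.2.5. Let `E` be a real normed space, `Jt : E → End_ℝ(E)`, `g : ℂ → E` a
`Jt`-holomorphic map (`∂_y g = Jt(g) ∂ₓ g`), `L : E → (ℂ →L[ℝ] E)` a frame which is
complex-linear for `Jt` (`L(y)(iw) = Jt(y) L(y) w`), and suppose

  `g(z') = g(φ̃ z') + L(g(φ̃ z')) η̃(z')`   near `z`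

with `φ̃, η̃ : ℂ → ℂ` differentiable at `z`. If `P : E →L[ℝ] ℂ` kills the (complex) tangent line
`Dg(φ̃ z)(ℂ)` and inverts the frame, `P ∘ L(g(φ̃ z)) = id`, then (`norm_dbar_le_of_pushoff`)

  `‖∂ₓη̃ + i ∂_yη̃‖(z) ≤ ‖P‖ · (K ‖L‖ (‖Dg(φ̃ z)‖ ‖Dφ̃‖ + ‖L‖ ‖Dη̃‖) + (1 + ‖Jt(g z)‖) ‖DL‖ ‖Dg(φ̃ z)‖ ‖Dφ̃‖) · |η̃(z)|`,

where `K ≥ 0` is a Lipschitz constant of `Jt` between `g z` and `g(φ̃ z)`. This is the source of the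
linear Cauchy–Riemann type inequality `|∂̄η̃| ≤ M |η̃|` for the normal section `η̃` in the proof of
the local representation formula (Thm B.23, §B.2.5), here WITHOUT connections or parallel
transport: differentiating the identity and taking `∂_y - Jt(g z) ∂ₓ`, the term coming from `φ̃`
(which is not holomorphic) lies in the `Jt`-complex line `Dg(φ̃ z)(ℂ)` up to `O(|η̃|)` and is
killed by `P`, the frame term gives exactly `∂̄η̃`, and everything else carries a factor `η̃`.
Brick B3e of the blueprint for `Literature.Geometry.Symplectic.jHolomorphic_localBranchDichotomy`.

Everything is proved; no named facts.

## References

* C. Wendl, *Lectures on Contact 3-Manifolds, Holomorphic Curves and Intersection Theory*,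
  Cambridge Tracts in Math. 220 (2020), App. B, Prop. B.28 and §B.2.5. [Wendl2020]
* M. Micallef, B. White, *The structure of branch points in minimal surfaces and in
  pseudoholomorphic curves*, Ann. of Math. 141 (1995), §6. [MicallefWhite1995]
-/

noncomputable section

open scoped Topology
open Set Filter Metric Function Complex

namespace Literature.Geometry.Symplectic.NormalPushoff

variable {E : Type*} [NormedAddCommGroup E] [NormedSpace ℝ E]

/-- A `Jt`-holomorphic differential is `Jt`-complex-linear: `Jt (A a) = A (i a)` for all `a`
(from `A i = Jt (A 1)` and `Jt² = -1`). [folklore] -/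
theorem J_apply_eq_apply_I_mul {Jt : E →L[ℝ] E} {A : ℂ →L[ℝ] E} (hhol : A I = Jt (A 1))
    (hJ2 : ∀ v, Jt (Jt v) = -v) (a : ℂ) : Jt (A a) = A (I * a) := by
  have ha : a = a.re • (1 : ℂ) + a.im • I := by
    simp [real_smul, re_add_im]
  have hIa : I * a = (-a.im) • (1 : ℂ) + a.re • I := by
    apply Complex.ext <;> simp
  conv_lhs => rw [ha]
  rw [hIa, map_add, map_smul, map_smul, map_add, map_smul, map_smul, map_add, map_smul, map_smul,
    hhol, hJ2]
  simp only [smul_neg, neg_smul]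
  abel

/-- **The `∂̄`-inequality for the normal section of a push-off** (pointwise form of Wendl 2020,
Prop. B.28, flat and explicit). See the module docstring.
[cite: Wendl2020, App. B, Prop. B.28 and §B.2.5] -/
theorem norm_dbar_le_of_pushoff {Jt : E → E →L[ℝ] E} {g : ℂ → E} {L : E → ℂ →L[ℝ] E}
    {L' : E →L[ℝ] ℂ →L[ℝ] E} {φt ηt : ℂ → ℂ} {Φ' N' : ℂ →L[ℝ] ℂ} {z : ℂ} {P : E →L[ℝ] ℂ}
    {K : ℝ} (hgζ : DifferentiableAt ℝ g (φt z))
    (hholz : fderiv ℝ g z I = Jt (g z) (fderiv ℝ g z 1))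
    (hholζ : fderiv ℝ g (φt z) I = Jt (g (φt z)) (fderiv ℝ g (φt z) 1))
    (hJ2 : ∀ v, Jt (g (φt z)) (Jt (g (φt z)) v) = -v)
    (hL : HasFDerivAt L L' (g (φt z)))
    (hLI : ∀ w, L (g (φt z)) (I * w) = Jt (g (φt z)) (L (g (φt z)) w))
    (hφ : HasFDerivAt φt Φ' z) (hη : HasFDerivAt ηt N' z)
    (hid : ∀ᶠ z' in 𝓝 z, g z' = g (φt z') + L (g (φt z')) (ηt z'))
    (hP1 : ∀ c, P (fderiv ℝ g (φt z) c) = 0) (hP2 : ∀ w, P (L (g (φt z)) w) = w)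
    (hK0 : 0 ≤ K) (hK : ‖Jt (g z) - Jt (g (φt z))‖ ≤ K * ‖g z - g (φt z)‖) :
    ‖N' 1 + I * N' I‖ ≤ ‖P‖ * (K * ‖L (g (φt z))‖ *
        (‖fderiv ℝ g (φt z)‖ * ‖Φ'‖ + ‖L (g (φt z))‖ * ‖N'‖) +
      (1 + ‖Jt (g z)‖) * ‖L'‖ * ‖fderiv ℝ g (φt z)‖ * ‖Φ'‖) * ‖ηt z‖ := by
  -- notation
  set x : E := g z with hx
  set y : E := g (φt z) with hy
  set A : ℂ →L[ℝ] E := fderiv ℝ g (φt z) with hA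
  set η : ℂ := ηt z with hηdef
  -- ### the derivative of the right-hand side
  have h1 : HasFDerivAt (fun z' => g (φt z')) (A.comp Φ') z := hgζ.hasFDerivAt.comp z hφ
  have h2 : HasFDerivAt (fun z' => L (g (φt z'))) (L'.comp (A.comp Φ')) z := hL.comp z h1
  have h3 : HasFDerivAt (fun z' => L (g (φt z')) (ηt z'))
      ((L y).comp N' + (L'.comp (A.comp Φ')).flip η) z := h2.clm_apply hη
  have h4 : HasFDerivAt g (A.comp Φ' + ((L y).comp N' + (L'.comp (A.comp Φ')).flip η)) z :=
    (h1.add h3).congr_of_eventuallyEq hid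
  have hstar : ∀ c, fderiv ℝ g z c = A (Φ' c) + (L y (N' c) + (L' (A (Φ' c))) η) := by
    intro c; rw [h4.fderiv]; rfl
  -- ### the identity `x - y = L y η`
  have hxy : x - y = L y η := by
    have := hid.self_of_nhds
    rw [hx, hy, hηdef, this]; abel
  -- ### the key algebraic identity
  have hholζ' : ∀ a, Jt y (A a) = A (I * a) := J_apply_eq_apply_I_mul hholζ hJ2
  have hkey : N' I - I * N' 1 =
      P ((Jt x - Jt y) (A (Φ' 1))) + P ((Jt x - Jt y) (L y (N' 1))) +
        P (Jt x ((L' (A (Φ' 1))) η)) - P ((L' (A (Φ' I))) η) := by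
    have eL : P (fderiv ℝ g z I) = N' I + P ((L' (A (Φ' I))) η) := by
      rw [hstar I, map_add, map_add, hP1, zero_add, hP2]
    have s1 : Jt x (A (Φ' 1)) = A (I * Φ' 1) + (Jt x - Jt y) (A (Φ' 1)) := by
      rw [← hholζ']; simp
    have s2 : Jt x (L y (N' 1)) = L y (I * N' 1) + (Jt x - Jt y) (L y (N' 1)) := by
      rw [hLI]; simp
    have eR : P (Jt x (fderiv ℝ g z 1)) = P ((Jt x - Jt y) (A (Φ' 1))) +
        (I * N' 1 + P ((Jt x - Jt y) (L y (N' 1))) + P (Jt x ((L' (A (Φ' 1))) η))) := by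
      rw [hstar 1]
      simp only [map_add, s1, s2, hP1, hP2, zero_add]
    have e0 : P (fderiv ℝ g z I) = P (Jt x (fderiv ℝ g z 1)) := by rw [hholz]
    rw [eL, eR] at e0
    linear_combination e0
  -- ### `∂̄η̃ = I • (N' I - I N' 1)`
  have hdbar : N' 1 + I * N' I = I * (N' I - I * N' 1) := by ring_nf; rw [I_sq]; ring
  -- ### norm bounds
  have hJdiff : ‖Jt x - Jt y‖ ≤ K * ‖L y‖ * ‖η‖ := by
    calc ‖Jt x - Jt y‖ ≤ K * ‖x - y‖ := hK
      _ = K * ‖L y η‖ := by rw [hxy]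
      _ ≤ K * (‖L y‖ * ‖η‖) := by gcongr; exact (L y).le_opNorm η
      _ = K * ‖L y‖ * ‖η‖ := by ring
  have hΦ1 : ‖Φ' 1‖ ≤ ‖Φ'‖ := by simpa using Φ'.le_opNorm (1 : ℂ)
  have hΦI : ‖Φ' I‖ ≤ ‖Φ'‖ := by simpa using Φ'.le_opNorm I
  have hN1 : ‖N' 1‖ ≤ ‖N'‖ := by simpa using N'.le_opNorm (1 : ℂ)
  have nA1 : ‖A (Φ' 1)‖ ≤ ‖A‖ * ‖Φ'‖ := (A.le_opNorm _).trans (by gcongr)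
  have nAI : ‖A (Φ' I)‖ ≤ ‖A‖ * ‖Φ'‖ := (A.le_opNorm _).trans (by gcongr)
  have nL1 : ‖L y (N' 1)‖ ≤ ‖L y‖ * ‖N'‖ := ((L y).le_opNorm _).trans (by gcongr)
  have nLA : ∀ v : E, ‖v‖ ≤ ‖A‖ * ‖Φ'‖ → ‖(L' v) η‖ ≤ ‖L'‖ * ‖A‖ * ‖Φ'‖ * ‖η‖ := by
    intro v hv
    calc ‖(L' v) η‖ ≤ ‖L' v‖ * ‖η‖ := (L' v).le_opNorm η
      _ ≤ ‖L'‖ * ‖v‖ * ‖η‖ := by gcongr; exact L'.le_opNorm v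
      _ ≤ ‖L'‖ * (‖A‖ * ‖Φ'‖) * ‖η‖ := by gcongr
      _ = ‖L'‖ * ‖A‖ * ‖Φ'‖ * ‖η‖ := by ring
  have hb1 : ‖P ((Jt x - Jt y) (A (Φ' 1)))‖ ≤ ‖P‖ * ((K * ‖L y‖ * ‖η‖) * (‖A‖ * ‖Φ'‖)) := by
    calc ‖P ((Jt x - Jt y) (A (Φ' 1)))‖ ≤ ‖P‖ * ‖(Jt x - Jt y) (A (Φ' 1))‖ := P.le_opNorm _
      _ ≤ ‖P‖ * (‖Jt x - Jt y‖ * ‖A (Φ' 1)‖) := by gcongr; exact (Jt x - Jt y).le_opNorm _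
      _ ≤ ‖P‖ * ((K * ‖L y‖ * ‖η‖) * (‖A‖ * ‖Φ'‖)) := by gcongr
  have hb2 : ‖P ((Jt x - Jt y) (L y (N' 1)))‖ ≤ ‖P‖ * ((K * ‖L y‖ * ‖η‖) * (‖L y‖ * ‖N'‖)) := by
    calc ‖P ((Jt x - Jt y) (L y (N' 1)))‖ ≤ ‖P‖ * ‖(Jt x - Jt y) (L y (N' 1))‖ := P.le_opNorm _
      _ ≤ ‖P‖ * (‖Jt x - Jt y‖ * ‖L y (N' 1)‖) := by gcongr; exact (Jt x - Jt y).le_opNorm _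
      _ ≤ ‖P‖ * ((K * ‖L y‖ * ‖η‖) * (‖L y‖ * ‖N'‖)) := by gcongr
  have hb3 : ‖P (Jt x ((L' (A (Φ' 1))) η))‖ ≤ ‖P‖ * (‖Jt x‖ * (‖L'‖ * ‖A‖ * ‖Φ'‖ * ‖η‖)) := by
    calc ‖P (Jt x ((L' (A (Φ' 1))) η))‖ ≤ ‖P‖ * ‖Jt x ((L' (A (Φ' 1))) η)‖ := P.le_opNorm _
      _ ≤ ‖P‖ * (‖Jt x‖ * ‖(L' (A (Φ' 1))) η‖) := by gcongr; exact (Jt x).le_opNorm _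
      _ ≤ ‖P‖ * (‖Jt x‖ * (‖L'‖ * ‖A‖ * ‖Φ'‖ * ‖η‖)) := by gcongr; exact nLA _ nA1
  have hb4 : ‖P ((L' (A (Φ' I))) η)‖ ≤ ‖P‖ * (‖L'‖ * ‖A‖ * ‖Φ'‖ * ‖η‖) :=
    (P.le_opNorm _).trans (by gcongr; exact nLA _ nAI)
  -- ### conclusion
  rw [hdbar, norm_mul, norm_I, one_mul, hkey]
  calc ‖P ((Jt x - Jt y) (A (Φ' 1))) + P ((Jt x - Jt y) (L y (N' 1))) +
          P (Jt x ((L' (A (Φ' 1))) η)) - P ((L' (A (Φ' I))) η)‖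
      ≤ ‖P ((Jt x - Jt y) (A (Φ' 1)))‖ + ‖P ((Jt x - Jt y) (L y (N' 1)))‖ +
          ‖P (Jt x ((L' (A (Φ' 1))) η))‖ + ‖P ((L' (A (Φ' I))) η)‖ := by
        refine (norm_sub_le _ _).trans ?_
        gcongr
        exact (norm_add_le _ _).trans (by gcongr; exact norm_add_le _ _)
    _ ≤ ‖P‖ * ((K * ‖L y‖ * ‖η‖) * (‖A‖ * ‖Φ'‖)) +
          ‖P‖ * ((K * ‖L y‖ * ‖η‖) * (‖L y‖ * ‖N'‖)) +
          ‖P‖ * (‖Jt x‖ * (‖L'‖ * ‖A‖ * ‖Φ'‖ * ‖η‖)) + ‖P‖ * (‖L'‖ * ‖A‖ * ‖Φ'‖ * ‖η‖) := by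
        gcongr
    _ = ‖P‖ * (K * ‖L y‖ * (‖A‖ * ‖Φ'‖ + ‖L y‖ * ‖N'‖) +
          (1 + ‖Jt x‖) * ‖L'‖ * ‖A‖ * ‖Φ'‖) * ‖η‖ := by ring

end Literature.Geometry.Symplectic.NormalPushoff

end
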